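import Literature.Geometry.Manifold.DeRhamBootstrap
import Literature.AlgebraicTopology.SingularHomology.CohomologyHomotopyInvariance
import HarnessLib

/-!
# The de Rham comparison isomorphism `H^k_dR(M) ≅ H^k(M; ℝ)` and its naturality

Assembly, at the level of the whole manifold, of the integration proof of **de Rham's theorem**
(de Rham 1931; Bredon (1993), Thm. V.9.5; Lee (2013), Thm. 18.14): for a `C^∞` manifold `M`
(Hausdorff, second countable, finite-dimensional boundaryless model) the composite

`H^k_dR(M) ≅ Hᵏ(Ω•(univ)) →[Ψ] Hᵏ(Hom(Δ^{sm}(M), ℝ)) ←[res] Hᵏ(Hom(Δ(M), ℝ)) ≅ Hᵏ(M; ℝ)`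

consists of isomorphisms (`good_univ` of `DeRhamBootstrap` for the two middle arrows), giving
`deRhamComparisonIso : Hᵏ(Ω•(univ)) ≅ singularCohomology ℝ ℝ M k` and the identification
`deRhamIsoLocal : deRhamCohomology I M ℝ k ≃ₗ[ℝ] Hᵏ(Ω•(univ))` of the tree's de Rham cohomology
(`ManifoldForms`) with the cohomology of the de Rham complex of `univ`. All pieces are natural
for `C^∞` maps (`deRhamToLocal_map`, `pullbackUniv_comp_deRhamMap`, `toSmoothAll_naturality`,
`singIso_hom_naturality`).

## References

* G. E. Bredon, *Topology and Geometry*, GTM 139 (1993), Thm. V.9.5.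
* J. M. Lee, *Introduction to Smooth Manifolds*, 2nd ed. (2013), Thm. 18.14.
-/

noncomputable section

-- see "Implementation notes" in `…SingularHomology.SingularChainsConcrete`
set_option backward.isDefEq.respectTransparency false

open scoped Manifold ContDiff Topology
open CategoryTheory Limits Set Literature.AlgebraicTopology.SingularHomology Literature.Geometry.Kaehler

universe u

namespace Literature.Geometry.Manifold

variable {E : Type u} [NormedAddCommGroup E] [NormedSpace ℝ E]
  {H : Type u} [TopologicalSpace H] {I : ModelWithCorners ℝ E H}
  {M : Type u} [TopologicalSpace M] [ChartedSpace H M] [IsManifold I ∞ M]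

/-! ### De Rham cohomology as the cohomology of `Ω•(univ)` -/

section DeRham

variable {F : Type} [NormedAddCommGroup F] [NormedSpace ℝ F] {k : ℕ}

/-- An exact smooth form on `M` is exact on `univ` (converse of the tree's
`mem_exactSmoothForms_of_mem_localExactForms_univ`). [folklore] -/
theorem mem_localExactForms_univ_of_mem_exactSmoothForms {α : MForm I M F k}
    (hα : α ∈ exactSmoothForms I M F k) : α ∈ localExactForms I F (isOpen_univ : IsOpen (univ : Set M)) k := by
  cases k with
  | zero =>
    change α ∈ (⊥ : Submodule ℝ _) at hα
    rw [Submodule.mem_bot] at hα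
    rw [hα]
    exact Submodule.zero_mem _
  | succ k =>
    change α ∈ Submodule.span ℝ (mextDeriv '' (smoothForms I M F k : Set (MForm I M F k))) at hα
    refine Submodule.span_le.2 ?_ hα
    rintro _ ⟨β, hβ, rfl⟩
    rw [SetLike.mem_coe, mem_localExactForms_succ_iff]
    refine ⟨⟨β, by rw [smoothFormsOn_univ]; exact hβ⟩, ?_⟩
    rw [coe_localD, MForm.restr_univ]

variable (I M F k) in
/-- A closed smooth form as an element of the de Rham complex of `univ`. [folklore] -/
def closedToUniv : closedSmoothForms I M F k →ₗ[ℝ] (localDeRhamComplex I F (isOpen_univ : IsOpen (univ : Set M))).X k where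
  toFun α := ⟨α.1, (mem_localClosedForms_univ_of_mem_closedSmoothForms α.2).1⟩
  map_add' _ _ := rfl
  map_smul' _ _ := rfl

/-- A closed smooth form is a cocycle of the de Rham complex of `univ`. [folklore] -/
theorem d_closedToUniv (α : closedSmoothForms I M F k) :
    (localDeRhamComplex I F (isOpen_univ : IsOpen (univ : Set M))).d k ((ComplexShape.down ℕ).symm.next k)
      (closedToUniv I M F k α) = 0 := by
  rw [d_next_eq_zero_iff ((ComplexShape.down ℕ).symm.next_eq' (rfl : k + 1 = k + 1)), localDeRhamComplex_d]
  exact (mem_localClosedForms_iff_localD_eq_zero isOpen_univ _).1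
    (mem_localClosedForms_univ_of_mem_closedSmoothForms α.2)

variable (I M F k) in
/-- The class in `Hᵏ(Ω•(univ))` of a closed smooth form, a linear map. [folklore] -/
def closedToLocalHomology :
    closedSmoothForms I M F k →ₗ[ℝ] ((localDeRhamComplex I F (isOpen_univ : IsOpen (univ : Set M))).homology k) where
  toFun α := homologyCls (closedToUniv I M F k α) (d_closedToUniv α)
  map_add' α β := by
    rw [← homologyCls_add _ _ (d_closedToUniv α) (d_closedToUniv β)
      (by rw [map_add, d_closedToUniv, d_closedToUniv, add_zero])]
    exact homologyCls_congr (map_add _ _ _) _ _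
  map_smul' r α := by
    rw [RingHom.id_apply, ← homologyCls_smul r _ (d_closedToUniv α)
      (by rw [map_smul, d_closedToUniv, smul_zero])]
    exact homologyCls_congr (map_smul _ _ _) _ _

/-- Exact forms have zero class in `Hᵏ(Ω•(univ))`. [folklore] -/
theorem closedToLocalHomology_eq_zero_of_mem_exact (α : closedSmoothForms I M F k)
    (hα : (α : MForm I M F k) ∈ exactSmoothForms I M F k) : closedToLocalHomology I M F k α = 0 := by
  change homologyCls _ _ = 0
  rw [homologyCls_eq_zero_iff]
  have hα' := mem_localExactForms_univ_of_mem_exactSmoothForms hα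
  cases k with
  | zero =>
    change (α : MForm I M F 0) ∈ (⊥ : Submodule ℝ _) at hα'
    rw [Submodule.mem_bot] at hα'
    rw [exists_d_prev_eq_iff symm_down_prev_zero]
    refine ⟨0, ?_⟩
    rw [d_prev_zero_apply]
    exact (Subtype.ext hα').symm
  | succ k =>
    obtain ⟨β, hβ⟩ := (mem_localExactForms_succ_iff isOpen_univ).1 hα'
    rw [exists_d_prev_eq_iff ((ComplexShape.down ℕ).symm.prev_eq' (rfl : k + 1 = k + 1))]
    refine ⟨β, ?_⟩
    rw [localDeRhamComplex_d]
    exact Subtype.ext hβ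

variable (I M F k) in
/-- **The comparison `H^k_dR(M) → Hᵏ(Ω•(univ))`** (identity on representatives). [folklore] -/
def deRhamToLocal :
    deRhamCohomology I M F k →ₗ[ℝ] ((localDeRhamComplex I F (isOpen_univ : IsOpen (univ : Set M))).homology k) :=
  Submodule.liftQ _ (closedToLocalHomology I M F k) fun α hα ↦
    closedToLocalHomology_eq_zero_of_mem_exact α hα

/-- The comparison on a class. [folklore] -/
theorem deRhamToLocal_mk (α : closedSmoothForms I M F k) :
    deRhamToLocal I M F k (deRhamCohomology.mk α) = homologyCls (closedToUniv I M F k α) (d_closedToUniv α) :=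
  rfl

/-- **`H^k_dR(M) → Hᵏ(Ω•(univ))` is bijective.** [folklore] -/
theorem deRhamToLocal_bijective : Function.Bijective (deRhamToLocal I M F k) := by
  constructor
  · rw [injective_iff_map_eq_zero]
    intro c hc
    obtain ⟨α, rfl⟩ := deRhamCohomology.mk_surjective c
    rw [deRhamToLocal_mk, homologyCls_eq_zero_iff] at hc
    -- `α` is exact on `univ`, hence exact
    have hex : (α : MForm I M F k) ∈ localExactForms I F (isOpen_univ : IsOpen (univ : Set M)) k := by
      cases k with
      | zero =>
        rw [exists_d_prev_eq_iff symm_down_prev_zero] at hc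
        obtain ⟨w, hw⟩ := hc
        rw [d_prev_zero_apply] at hw
        have h0 : (α : MForm I M F 0) = 0 := congrArg Subtype.val hw.symm
        rw [h0]
        exact Submodule.zero_mem _
      | succ k =>
        rw [exists_d_prev_eq_iff ((ComplexShape.down ℕ).symm.prev_eq' (rfl : k + 1 = k + 1))] at hc
        obtain ⟨β, hβ⟩ := hc
        rw [localDeRhamComplex_d] at hβ
        exact (mem_localExactForms_succ_iff isOpen_univ).2 ⟨β, congrArg Subtype.val hβ⟩
    have : deRhamCohomology.mk α = deRhamCohomology.mk 0 := by
      rw [deRhamCohomology.mk_eq_mk_iff, Submodule.coe_zero, sub_zero]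
      exact mem_exactSmoothForms_of_mem_localExactForms_univ hex
    rw [this, map_zero]
  · intro x
    obtain ⟨z, hz, rfl⟩ := homologyCls_surjective x
    have hzc : (z.1 : MForm I M F k) ∈ closedSmoothForms I M F k := by
      refine mem_closedSmoothForms_of_mem_localClosedForms_univ ?_
      rw [mem_localClosedForms_iff_localD_eq_zero isOpen_univ]
      rw [d_next_eq_zero_iff ((ComplexShape.down ℕ).symm.next_eq' (rfl : k + 1 = k + 1)), localDeRhamComplex_d] at hz
      exact hz
    exact ⟨deRhamCohomology.mk ⟨z.1, hzc⟩, homologyCls_congr (Subtype.ext rfl) _ _⟩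

variable (I M F k) in
/-- **`H^k_dR(M) ≃ₗ[ℝ] Hᵏ(Ω•(univ))`**: the tree's de Rham cohomology (`ManifoldForms`) is the
cohomology of the de Rham complex of `univ`. [folklore] -/
def deRhamIsoLocal :
    deRhamCohomology I M F k ≃ₗ[ℝ] ((localDeRhamComplex I F (isOpen_univ : IsOpen (univ : Set M))).homology k) :=
  LinearEquiv.ofBijective (deRhamToLocal I M F k) deRhamToLocal_bijective

/-- The equivalence on a class. [folklore] -/
theorem deRhamIsoLocal_mk (α : closedSmoothForms I M F k) :
    deRhamIsoLocal I M F k (deRhamCohomology.mk α) = homologyCls (closedToUniv I M F k α) (d_closedToUniv α) :=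
  rfl

variable {E' : Type u} [NormedAddCommGroup E'] [NormedSpace ℝ E'] {H' : Type u} [TopologicalSpace H']
  {I' : ModelWithCorners ℝ E' H'} {N : Type u} [TopologicalSpace N] [ChartedSpace H' N] [IsManifold I' ∞ N]

/-- **Naturality of `H^k_dR → Hᵏ(Ω•(univ))`**: pull-back of classes corresponds to the morphism
induced by `localDeRhamComplex.pullbackUniv`. [folklore] -/
theorem deRhamToLocal_map [Literature.NumberTheory.Transcendental.PullbackFacts I M I' N ℝ]
    {f : M → N} (hf : ContMDiff I I' ∞ f) (c : deRhamCohomology I' N ℝ k) :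
    deRhamToLocal I M ℝ k (deRhamCohomology.map hf k c) =
      HomologicalComplex.homologyMap (localDeRhamComplex.pullbackUniv I hf) k (deRhamToLocal I' N ℝ k c) := by
  obtain ⟨β, rfl⟩ := deRhamCohomology.mk_surjective c
  rw [deRhamCohomology.map_mk, deRhamToLocal_mk, deRhamToLocal_mk, homologyMap_homologyCls]
  exact homologyCls_congr (Subtype.ext rfl) _ _

end DeRham

/-! ### All cochains versus smooth cochains on the whole manifold -/

section ToSmoothAll

variable (I M) in
/-- Restriction of cochains on all concrete singular chains of `M` to the smooth ones:
`Hom(Δ(M), ℝ) ⟶ Hom(Δ^{sm}(M), ℝ)`. [cite: Bredon1993, §V.9] -/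
abbrev toSmoothAll : dualObj ℝ realCoeff.{u} (csingularChainComplex ℝ ℝ M) ⟶
    smoothSubsetCochains I ℝ realCoeff.{u} M univ :=
  dualMap ℝ realCoeff (smoothChainsInSub I ℝ ℝ M univ).ι

omit [IsManifold I ∞ M] in
/-- `toSmoothAll` factors through the cochains of chains in `univ`. [folklore] -/
theorem toSmoothAll_eq :
    toSmoothAll I M = dualMap ℝ realCoeff (⊤ : Subcomplex (csingularChainComplex ℝ ℝ M)).ι ≫
      dualMap ℝ realCoeff (Subcomplex.incl (chainsInSub_univ ℝ ℝ (X := M)).le) ≫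
        smoothSubsetCochains.toSmooth I ℝ realCoeff univ := by
  rw [toSmoothAll, smoothSubsetCochains.toSmooth, ← dualMap_comp, ← dualMap_comp, Category.assoc,
    Subcomplex.incl_ι, Subcomplex.incl_ι]

/-- **Restriction to smooth chains is an isomorphism on the cohomology of `M`** (from
`good_univ`). [cite: Bredon1993, Thm. V.9.5] -/
theorem isIso_homologyMap_toSmoothAll [I.Boundaryless] [FiniteDimensional ℝ E] [T2Space M]
    [SecondCountableTopology M] [LocallyCompactSpace M] (k : ℕ) :
    IsIso (HomologicalComplex.homologyMap (toSmoothAll I M) k) := by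
  rw [toSmoothAll_eq, HomologicalComplex.homologyMap_comp, HomologicalComplex.homologyMap_comp]
  haveI := Subcomplex.isIso_incl_of_eq (chainsInSub_univ ℝ ℝ (X := M))
  haveI := (good_univ (I := I) (M := M)).isIso_toSmooth k
  infer_instance

variable {E' : Type u} [NormedAddCommGroup E'] [NormedSpace ℝ E'] {H' : Type u} [TopologicalSpace H']
  {I' : ModelWithCorners ℝ E' H'} {N : Type u} [TopologicalSpace N] [ChartedSpace H' N] [IsManifold I' ∞ N]

/-- **Naturality of `toSmoothAll`**: restriction to smooth chains commutes with push-forward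
along `C^∞` maps. [folklore] -/
@[reassoc]
theorem toSmoothAll_naturality {f : M → N} (hf : ContMDiff I I' ∞ f) :
    toSmoothAll I' N ≫ dualMap ℝ realCoeff (smoothPush hf) =
      dualMap ℝ realCoeff (csingularChainComplex.map ℝ ℝ ⟨f, hf.continuous⟩) ≫ toSmoothAll I M := by
  rw [toSmoothAll, toSmoothAll, ← dualMap_comp, ← dualMap_comp, smoothPush, Subcomplex.subMap_ι]

end ToSmoothAll

/-! ### Singular cochains versus the dual of concrete chains -/

section Sing

omit [ChartedSpace H M] [IsManifold I ∞ M]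

variable (M) in
/-- **`C•(M; ℝ) ≅ Hom(Δ(M), ℝ)`**: Mathlib's singular cochains are the dual of the concrete
singular chains (the tree's `cochainIso` and `compIso`). [cite: HatcherAT2002, §3.1 p. 197] -/
def singIso : singularCochainComplex ℝ ℝ M ≅ dualObj ℝ realCoeff.{u} (csingularChainComplex ℝ ℝ M) :=
  singularCochainComplex.cochainIso ℝ ℝ M ≪≫ dualMapIso (N := realCoeff.{u}) (csingularChainComplex.compIso ℝ ℝ M)

variable {N : Type u} [TopologicalSpace N]

/-- **Naturality of `singIso`.** [cite: HatcherAT2002, §3.1 p. 197] -/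
@[reassoc]
theorem singIso_hom_naturality (f : C(M, N)) :
    singularCochainComplex.map ℝ ℝ f ≫ (singIso M).hom =
      (singIso N).hom ≫ dualMap ℝ realCoeff (csingularChainComplex.map ℝ ℝ f) := by
  change singularCochainComplex.map ℝ ℝ f ≫ (singularCochainComplex.cochainIso ℝ ℝ M).hom ≫
      dualMap ℝ realCoeff (csingularChainComplex.compIso ℝ ℝ M).hom =
    ((singularCochainComplex.cochainIso ℝ ℝ N).hom ≫ dualMap ℝ realCoeff (csingularChainComplex.compIso ℝ ℝ N).hom) ≫
      dualMap ℝ realCoeff (csingularChainComplex.map ℝ ℝ f)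
  rw [singularCochainComplex.cochainIso_hom_naturality_assoc, Category.assoc, ← dualMap_comp, ← dualMap_comp,
    csingularChainComplex.map_comp_compIso_hom]

/-- The value of `singIso` on a cochain, on an elementary chain: `φ̂(r σ) = r φ(σ)`. [folklore] -/
theorem singIso_hom_f_apply_single {n : ℕ} (φ : (singularCochainComplex ℝ ℝ M).X n) (σ : SingularSimplex M n) (r : ℝ) :
    (ModuleCat.Hom.hom ((singIso M).hom.f n φ : (csingularChainComplex ℝ ℝ M).X n ⟶ realCoeff))
      (Finsupp.single σ r) = ULift.up (r * φ σ) := by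
  change (ModuleCat.Hom.hom ((csingularChainComplex.compIso ℝ ℝ M).hom.f n ≫
    singularCochainComplex.XIsoFun (R := ℝ) φ)) (Finsupp.single σ r) = _
  rw [ModuleCat.hom_comp, LinearMap.comp_apply]
  change singularCochainComplex.XIsoFun (R := ℝ) φ ((csingularChainComplex.compIso ℝ ℝ M).hom.f n (Finsupp.single σ r)) = _
  rw [csingularChainComplex.compIso_hom_f_single, singularCochainComplex.XIsoFun_single]
  rfl

end Sing

/-! ### The comparison isomorphism -/

section Comparison

variable [I.Boundaryless] [FiniteDimensional ℝ E] [T2Space M] [SecondCountableTopology M] [LocallyCompactSpace M]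

variable (I M) in
/-- **The de Rham comparison isomorphism `Hᵏ(Ω•(univ)) ≅ Hᵏ(M; ℝ)`**:
`Ψ`, then the inverse of the restriction to smooth chains, then the identification of the dual
of concrete chains with singular cochains (de Rham (1931); Bredon (1993), Thm. V.9.5;
Lee (2013), Thm. 18.14). [cite: Bredon1993, Thm. V.9.5] -/
def deRhamComparisonIso (k : ℕ) :
    (localDeRhamComplex I ℝ (isOpen_univ : IsOpen (univ : Set M))).homology k ≅ singularCohomology ℝ ℝ M k :=
  haveI := (good_univ (I := I) (M := M)).isIso_deRhamMap isOpen_univ k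
  haveI := isIso_homologyMap_toSmoothAll (I := I) (M := M) k
  asIso (HomologicalComplex.homologyMap (deRhamMap I (isOpen_univ : IsOpen (univ : Set M))) k) ≪≫
    (asIso (HomologicalComplex.homologyMap (toSmoothAll I M) k)).symm ≪≫
      ((HomologicalComplex.homologyFunctor _ _ k).mapIso (singIso M)).symm

/-- The defining relation of the comparison isomorphism:
`comparison ≫ H(singIso) ≫ H(toSmoothAll) = H(Ψ)`. [folklore] -/
@[reassoc]
theorem deRhamComparisonIso_hom_comp (k : ℕ) :
    (deRhamComparisonIso I M k).hom ≫ HomologicalComplex.homologyMap (singIso M).hom k ≫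
        HomologicalComplex.homologyMap (toSmoothAll I M) k =
      HomologicalComplex.homologyMap (deRhamMap I (isOpen_univ : IsOpen (univ : Set M))) k := by
  haveI := (good_univ (I := I) (M := M)).isIso_deRhamMap isOpen_univ k
  haveI := isIso_homologyMap_toSmoothAll (I := I) (M := M) k
  simp only [deRhamComparisonIso, Iso.trans_hom, Iso.symm_hom, Functor.mapIso_inv, asIso_hom, asIso_inv,
    HomologicalComplex.homologyFunctor_map, Category.assoc]
  have h1 : HomologicalComplex.homologyMap (singIso M).inv k ≫ HomologicalComplex.homologyMap (singIso M).hom k = 𝟙 _ := by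
    rw [← HomologicalComplex.homologyMap_comp, Iso.inv_hom_id, HomologicalComplex.homologyMap_id]
  rw [reassoc_of% h1, IsIso.inv_hom_id, Category.comp_id]

end Comparison

end Literature.Geometry.Manifold
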